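import Summits.CriticalPhenomena.CardyFormulaZ2.Theorems.CardyBoundaryCoulombGasRectilinearCardyStubRowBlocksPart4
import HarnessLib

/-!
# Stub B `stub_rowBlocks` of line `excursion-kernel-covariance`, part 5: the run through the window
# zone and the direction of the walk
# (crux `RectilinearCardy`, stmt-CriticalPhenomena-5660, route `CardyBoundaryCoulombGas`)

Continuation of part 4 (same setting: the lattice polygon `V = {x : δ x ∈ D̄}`, one enumeration `e`
of its exterior darts by the counter-clockwise walk, a ball `B(c, r)` on which `D̄ = {nrmC o ≥ h}`):

* `rb_zone_window` — **the run through the zone of the origin dart**: if `e 0 = (xZ, k₀)` is a row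
  dart next to `c`, then `2 n < P` (`n = ⌊r/(4δ)⌋₊ + 3`), the cycle marches straight forward from
  index `0` and straight backward from index `P`, and every dart whose vertex is within `r/4` of `c`
  is a row dart at index `j` or `P + j` with tangential coordinate `tng xZ + j s`, `|j| ≤ n`;
* `rb_direction` — **the walk runs towards increasing boundary parameter**: if the lifted feet `F`
  (non-decreasing, `η`-close to the darts' mesh points) of two darts of one run, `N` steps apart with
  `N δ ≥ 3 η`, both lie in a parameter window on which the tangential coordinate of the loop is
  strictly monotone with sign `sT`, then the tangential step sign `s` of the walk IS `sT`.

All [folklore].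
-/

noncomputable section

open Set Metric
open Literature.Probability.RandomPlanarGeometry
open Literature.Probability.LatticeModels (Site meshPoint Orient)
open Literature.Probability.LatticeModels.CollarLegModel (Dart dartTip dir dsucc outDart period neighbours)
open Summit.CriticalPhenomena.CardyFormulaZ2.Cruxes.BoundaryDefectGaussianR.RainbowMonomialsInExcursionKernels
  (tp_dir_val tp_dir_add_three)

namespace Summit.CriticalPhenomena.CardyFormulaZ2.Cruxes.RectilinearCardy.ExcursionKernelCovariance

/-! ### The run through the window zone -/

section Zone

variable {D : JordanDomain} {δ : ℝ} {V : Finset (ℤ × ℤ)} {e : ℕ → Dart} {P : ℕ} {o : Orient} {h r : ℝ}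
  {c : ℂ} {k₀ : Fin 4} {s : ℤ}

/-- A positive march moves: `P • dir k ≠ 0` for `P > 0`. [folklore] -/
theorem rb_nsmul_dir_ne_zero {P : ℕ} (hP : 0 < P) (k : Fin 4) : P • dir k ≠ (0 : ℤ × ℤ) := by
  obtain ⟨d0, d1, d2, d3⟩ := tp_dir_val
  intro h0
  rw [nsmul_eq_mul] at h0
  have h1 := congrArg Prod.fst h0
  have h2 := congrArg Prod.snd h0
  simp only [Prod.fst_mul, Prod.snd_mul, Prod.fst_natCast, Prod.snd_natCast, Prod.fst_zero, Prod.snd_zero] at h1 h2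
  fin_cases k <;> simp [d0, d1, d2, d3] at h1 h2 <;> omega

/-- **The run of the boundary cycle through the zone of the origin dart.** Inside `B(c, r)` let `D̄`
be the half-plane `{nrmC o ≥ h}`, `40 δ ≤ r`, and let the origin dart be a row dart `e 0 = (xZ, k₀)`
with `nrm xZ = ⌈h/δ⌉` within `2δ` of `c`. Then, with `n = ⌊r/(4δ)⌋₊ + 3`: `2 n < P`; the cycle marches
straight forward `e j = (xZ + j • dir (k₀ + 1), k₀)` and straight backward
`e (P - j) = (xZ + j • dir (k₀ + 3), k₀)` for `j ≤ n`; and every dart `e i`, `i < P`, whose vertex is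
within `r/4` of `c` is a row dart with tangential coordinate `tng xZ + j s`, `|j| ≤ n`, at index `i = j`
(`j ≥ 0`) or `i = P + j` (`j < 0`). [folklore] -/
theorem rb_zone_window (hδ : 0 < δ)
    (hV : ∀ x : ℤ × ℤ, x ∈ V ↔ meshPoint δ (![x.1, x.2] : Site 2) ∈ closure D.carrier)
    (hP : 0 < P) (hsucc : ∀ n, e (n + 1) = dsucc V (e n)) (hper : ∀ n, e (n + P) = e n)
    (hext : ∀ n, (e n).1 ∈ V ∧ dartTip (e n) ∉ V)
    (hnodup : ∀ n m, n < P → m < P → e n = e m → n = m)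
    (hcl : ∀ z, dist z c < r → (z ∈ closure D.carrier ↔ h ≤ Orient.nrmC o z))
    (htab : ∀ x : ℤ × ℤ,
      Orient.nrm o (![(x + dir k₀).1, (x + dir k₀).2] : Site 2) = Orient.nrm o (![x.1, x.2] : Site 2) - 1 ∧
      Orient.nrm o (![(x + dir (k₀ + 1)).1, (x + dir (k₀ + 1)).2] : Site 2) = Orient.nrm o (![x.1, x.2] : Site 2) ∧
      Orient.nrm o (![(x + dir (k₀ + 2)).1, (x + dir (k₀ + 2)).2] : Site 2) = Orient.nrm o (![x.1, x.2] : Site 2) + 1 ∧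
      Orient.nrm o (![(x + dir (k₀ + 3)).1, (x + dir (k₀ + 3)).2] : Site 2) = Orient.nrm o (![x.1, x.2] : Site 2) ∧
      Orient.tng o (![(x + dir (k₀ + 1)).1, (x + dir (k₀ + 1)).2] : Site 2) = Orient.tng o (![x.1, x.2] : Site 2) + s ∧
      Orient.tng o (![(x + dir (k₀ + 3)).1, (x + dir (k₀ + 3)).2] : Site 2) = Orient.tng o (![x.1, x.2] : Site 2) - s)
    (hk₀ : ∀ (x : ℤ × ℤ) (k : Fin 4),
      Orient.nrm o (![x.1, x.2] : Site 2) - 1 ≤ Orient.nrm o (![(x + dir k).1, (x + dir k).2] : Site 2) ∧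
      (Orient.nrm o (![(x + dir k).1, (x + dir k).2] : Site 2) = Orient.nrm o (![x.1, x.2] : Site 2) - 1 ↔ k = k₀))
    (hs : s = 1 ∨ s = -1) (hrδ : 40 * δ ≤ r)
    {xZ : ℤ × ℤ} (h0 : e 0 = (xZ, k₀)) (hxn : Orient.nrm o (![xZ.1, xZ.2] : Site 2) = ⌈h / δ⌉)
    (hxdist : dist (meshPoint δ (![xZ.1, xZ.2] : Site 2)) c < 2 * δ) :
    2 * (⌊r / (4 * δ)⌋₊ + 3) < P ∧
      (∀ j ≤ ⌊r / (4 * δ)⌋₊ + 3, e j = (xZ + j • dir (k₀ + 1), k₀)) ∧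
      (∀ j ≤ ⌊r / (4 * δ)⌋₊ + 3, e (P - j) = (xZ + j • dir (k₀ + 3), k₀)) ∧
      ∀ i < P, dist (meshPoint δ (![(e i).1.1, (e i).1.2] : Site 2)) c < r / 4 →
        Orient.nrm o (![(e i).1.1, (e i).1.2] : Site 2) = ⌈h / δ⌉ ∧ (e i).2 = k₀ ∧
        ((neighbours (e i).1).filter (fun y ↦ y ∉ V)).card = 1 ∧
        ∃ j : ℤ, |j| ≤ (⌊r / (4 * δ)⌋₊ + 3 : ℕ) ∧
          Orient.tng o (![(e i).1.1, (e i).1.2] : Site 2) = Orient.tng o (![xZ.1, xZ.2] : Site 2) + j * s ∧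
          ((0 ≤ j ∧ (i : ℤ) = j) ∨ (j < 0 ∧ (i : ℤ) = P + j)) := by
  set n : ℕ := ⌊r / (4 * δ)⌋₊ + 3 with hn
  have hr : 0 < r := by linarith
  -- size of the run
  have hnδ : (n : ℝ) * δ ≤ r / 4 + 3 * δ := by
    have h1 : (⌊r / (4 * δ)⌋₊ : ℝ) ≤ r / (4 * δ) := Nat.floor_le (by positivity)
    have h2 : (n : ℝ) = ⌊r / (4 * δ)⌋₊ + 3 := by rw [hn]; push_cast; ring
    rw [h2, add_mul]
    have h3 : (⌊r / (4 * δ)⌋₊ : ℝ) * δ ≤ r / (4 * δ) * δ := mul_le_mul_of_nonneg_right h1 hδ.le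
    rw [div_mul_eq_mul_div, mul_div_mul_right _ _ hδ.ne'] at h3
    linarith
  have hnlt : r / (4 * δ) < (n : ℝ) - 2 := by
    have h1 := Nat.lt_floor_add_one (r / (4 * δ))
    have h2 : (n : ℝ) = ⌊r / (4 * δ)⌋₊ + 3 := by rw [hn]; push_cast; ring
    linarith
  have hrun : dist (meshPoint δ (![xZ.1, xZ.2] : Site 2)) c + (n + 2) * δ < r := by nlinarith
  have hk₁ : ∀ x : ℤ × ℤ, Orient.nrm o (![(x + dir (k₀ + 1)).1, (x + dir (k₀ + 1)).2] : Site 2) =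
      Orient.nrm o (![x.1, x.2] : Site 2) := fun x => (htab x).2.1
  -- forward march from the origin
  have hfwd : ∀ j ≤ n, e j = (xZ + j • dir (k₀ + 1), k₀) := by
    intro j hj
    have := rb_march_fwd hδ hV hsucc hcl hk₀ hk₁ h0 hxn hrun j hj
    rwa [zero_add] at this
  have hnP : n < P := by
    by_contra hge
    rw [not_lt] at hge
    have h1 := hfwd P hge
    rw [← zero_add P, hper, zero_add, h0] at h1
    have h2 : xZ + P • dir (k₀ + 1) = xZ := (congrArg Prod.fst h1).symm
    exact rb_nsmul_dir_ne_zero hP (k₀ + 1) (by simpa using h2)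
  -- backward march from the origin
  have hbwd : ∀ j ≤ n, e (P - j) = (xZ + j • dir (k₀ + 3), k₀) := by
    intro j hj
    have := rb_march_bwd hδ hV hsucc hper hext hcl htab hk₀ h0 hxn hrun hnP j hj
    rwa [zero_add] at this
  have h2n : 2 * n < P := by
    by_contra hge
    rw [not_lt] at hge
    have hj : P - n ≤ n := by omega
    have h1 := hfwd (P - n) hj
    have h2 := hbwd n le_rfl
    rw [h1] at h2
    have h3 : xZ + (P - n) • dir (k₀ + 1) = xZ + n • dir (k₀ + 3) := congrArg Prod.fst h2
    rw [tp_dir_add_three k₀, smul_neg] at h3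
    have h4 : (P - n) • dir (k₀ + 1) + n • dir (k₀ + 1) = 0 := by
      have := add_left_cancel h3
      rw [this, neg_add_cancel]
    rw [← add_nsmul, Nat.sub_add_cancel hnP.le] at h4
    exact rb_nsmul_dir_ne_zero hP (k₀ + 1) h4
  refine ⟨h2n, hfwd, hbwd, fun i hi hid => ?_⟩
  -- capture of a dart near `c`
  have hid' : dist (meshPoint δ (![(e i).1.1, (e i).1.2] : Site 2)) c + δ < r := by linarith
  have htip : (e i).1 + dir (e i).2 ∉ V := (hext i).2
  obtain ⟨hrow, hdir⟩ := rb_ext_dart_row hV hδ hcl hk₀ hid' (hext i).1 htip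
  obtain ⟨-, -, -, hcard, -⟩ := rb_row_vertex hV hδ hcl hk₀ hid' hrow
  refine ⟨hrow, hdir, hcard, ?_⟩
  set d : ℤ := Orient.tng o (![(e i).1.1, (e i).1.2] : Site 2) - Orient.tng o (![xZ.1, xZ.2] : Site 2) with hd
  have hdabs : |(d : ℝ)| * δ < r / 4 + 2 * δ := by
    have h1 : |Orient.tngC o (meshPoint δ (![(e i).1.1, (e i).1.2] : Site 2)) -
        Orient.tngC o (meshPoint δ (![xZ.1, xZ.2] : Site 2))| ≤
        dist (meshPoint δ (![(e i).1.1, (e i).1.2] : Site 2)) (meshPoint δ (![xZ.1, xZ.2] : Site 2)) := by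
      rw [← Orient.tngC_sub, dist_eq_norm]; exact Orient.abs_tngC_le_norm o _
    rw [Orient.tngC_meshPoint, Orient.tngC_meshPoint, ← mul_sub, abs_mul, abs_of_pos hδ] at h1
    have h2 := dist_triangle (meshPoint δ (![(e i).1.1, (e i).1.2] : Site 2)) c (meshPoint δ (![xZ.1, xZ.2] : Site 2))
    rw [dist_comm c] at h2
    have h3 : ((Orient.tng o (![(e i).1.1, (e i).1.2] : Site 2) : ℤ) : ℝ) -
        ((Orient.tng o (![xZ.1, xZ.2] : Site 2) : ℤ) : ℝ) = (d : ℝ) := by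
      rw [hd]; push_cast; ring
    rw [h3] at h1
    nlinarith [abs_nonneg (d : ℝ)]
  have hdn : |d| ≤ n := by
    have h1 : |(d : ℝ)| < n := by
      by_contra hge
      rw [not_lt] at hge
      have := mul_le_mul_of_nonneg_right hge hδ.le
      have h4 : r / (4 * δ) * δ = r / 4 := by field_simp
      nlinarith
    have h2 : |d| < (n : ℤ) := by exact_mod_cast h1
    exact h2.le
  set j : ℤ := d * s with hj
  have hs2 : s * s = 1 := by rcases hs with rfl | rfl <;> norm_num
  have hjabs : |j| = |d| := by rw [hj, abs_mul]; rcases hs with rfl | rfl <;> simp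
  have hdj : d = j * s := by rw [hj, mul_assoc, hs2, mul_one]
  refine ⟨j, by rw [hjabs]; exact_mod_cast hdn, by rw [← hdj, hd]; ring, ?_⟩
  have hvert : (e i).1 = xZ + j • dir (k₀ + 1) := by
    apply rb_site_eq o
    · rw [(rb_zsmul_coords htab xZ j).2, ← hdj, hd]; ring
    · rw [(rb_zsmul_coords htab xZ j).1, hxn, hrow]
  have hei : e i = (xZ + j • dir (k₀ + 1), k₀) := Prod.ext hvert hdir
  rcases le_or_gt 0 j with hj0 | hj0
  · left
    refine ⟨hj0, ?_⟩
    have hjn : j.toNat ≤ n := by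
      have : (j.toNat : ℤ) ≤ n := by rw [Int.toNat_of_nonneg hj0]; exact (le_abs_self j).trans (hjabs ▸ hdn)
      exact_mod_cast this
    have h1 := hfwd j.toNat hjn
    rw [rb_nsmul_eq_zsmul, Int.natCast_toNat_eq_self.2 hj0, ← hei] at h1
    have := hnodup _ _ (by omega) hi h1
    rw [← this, Int.natCast_toNat_eq_self.2 hj0]
  · right
    refine ⟨hj0, ?_⟩
    have hjn : (-j).toNat ≤ n := by
      have : ((-j).toNat : ℤ) ≤ n := by
        rw [Int.toNat_of_nonneg (by omega)]; exact (neg_le_abs j).trans (hjabs ▸ hdn)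
      exact_mod_cast this
    have hj1 : 1 ≤ (-j).toNat := by
      have : (1 : ℤ) ≤ (-j).toNat := by rw [Int.toNat_of_nonneg (by omega)]; omega
      exact_mod_cast this
    have h1 := hbwd (-j).toNat hjn
    rw [rb_nsmul_back, Int.natCast_toNat_eq_self.2 (by omega), neg_neg, ← hei] at h1
    have := hnodup _ _ (by omega) hi h1
    rw [← this]
    have h2 : ((P - (-j).toNat : ℕ) : ℤ) = P - (-j).toNat := by push_cast [(hjn.trans hnP.le)]; ring
    rw [h2, Int.toNat_of_nonneg (by omega)]; ring

end Zone

/-! ### The direction of the walk -/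

/-- **The walk runs towards increasing boundary parameter.** Let the feet `F` be non-decreasing and
`η`-close to the darts' mesh points, and let two darts of one straight run, `N` steps apart with
tangential coordinates differing by `N s` and `N δ ≥ 3 η`, have feet in a parameter window
`|t - tZ| ≤ θ` on which `T(t) = tngC o (∂D(t))` is strictly monotone with sign `sT`. Then `s = sT`:
the later dart has the larger foot (equal feet would put the two mesh points within `2η < N δ`), so
`T` moves by the sign `sT` between the feet, while it moves by `N δ s` up to `2η` between the mesh
points. [folklore] -/
theorem rb_direction (D : JordanDomain) {δ η θ tZ sT : ℝ} {o : Orient} {e : ℕ → Dart} {F : ℕ → ℝ} {s : ℤ}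
    {iZ N : ℕ} (hδ : 0 < δ) (hη : 0 < η) (hFmono : ∀ n, F n ≤ F (n + 1))
    (hFclose : ∀ n, dist (D.boundary (F n)) (meshPoint δ (![(e n).1.1, (e n).1.2] : Site 2)) ≤ η)
    (hs : s = 1 ∨ s = -1) (hsT : sT = 1 ∨ sT = -1)
    (hT : ∀ t t' : ℝ, |t - tZ| ≤ θ → |t' - tZ| ≤ θ → t < t' →
      0 < sT * (Orient.tngC o (D.boundary t') - Orient.tngC o (D.boundary t)))
    (hi : |F iZ - tZ| ≤ θ) (hiN : |F (iZ + N) - tZ| ≤ θ)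
    (htng : Orient.tng o (![(e (iZ + N)).1.1, (e (iZ + N)).1.2] : Site 2) =
      Orient.tng o (![(e iZ).1.1, (e iZ).1.2] : Site 2) + N * s)
    (hN : 3 * η ≤ N * δ) : (s : ℝ) = sT := by
  set p0 : ℂ := meshPoint δ (![(e iZ).1.1, (e iZ).1.2] : Site 2) with hp0
  set pN : ℂ := meshPoint δ (![(e (iZ + N)).1.1, (e (iZ + N)).1.2] : Site 2) with hpN
  have hmono : Monotone F := monotone_nat_of_le_succ hFmono
  have hle : F iZ ≤ F (iZ + N) := hmono (Nat.le_add_right iZ N)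
  -- tangential coordinates of the two mesh points
  have hdt : Orient.tngC o pN - Orient.tngC o p0 = N * δ * s := by
    rw [hpN, hp0, Orient.tngC_meshPoint, Orient.tngC_meshPoint, htng]; push_cast; ring
  -- the feet are `η`-close in the tangential coordinate
  have hc0 : |Orient.tngC o (D.boundary (F iZ)) - Orient.tngC o p0| ≤ η := by
    rw [← Orient.tngC_sub]
    exact (Orient.abs_tngC_le_norm o _).trans (by rw [← dist_eq_norm]; exact hFclose iZ)
  have hcN : |Orient.tngC o (D.boundary (F (iZ + N))) - Orient.tngC o pN| ≤ η := by
    rw [← Orient.tngC_sub]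
    exact (Orient.abs_tngC_le_norm o _).trans (by rw [← dist_eq_norm]; exact hFclose (iZ + N))
  have hs1 : |(s : ℝ)| = 1 := by rcases hs with rfl | rfl <;> simp
  -- the feet differ
  have hlt : F iZ < F (iZ + N) := by
    refine lt_of_le_of_ne hle fun heq => ?_
    have h1 : dist p0 pN ≤ 2 * η := by
      have t := dist_triangle p0 (D.boundary (F iZ)) pN
      have a : dist p0 (D.boundary (F iZ)) ≤ η := by rw [dist_comm]; exact hFclose iZ
      have b : dist (D.boundary (F iZ)) pN ≤ η := by rw [heq]; exact hFclose (iZ + N)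
      linarith
    have h2 : |Orient.tngC o pN - Orient.tngC o p0| ≤ dist p0 pN := by
      rw [← Orient.tngC_sub, dist_comm, dist_eq_norm]; exact Orient.abs_tngC_le_norm o _
    rw [hdt, abs_mul, hs1, mul_one, abs_of_nonneg (by positivity)] at h2
    linarith
  have hmain := hT _ _ hi hiN hlt
  rw [abs_le] at hc0 hcN
  rcases hs with rfl | rfl <;> rcases hsT with rfl | rfl
  · simp
  · exfalso
    simp only [Int.cast_one, mul_one] at hdt
    linarith [hc0.1, hc0.2, hcN.1, hcN.2]
  · exfalso
    simp only [Int.cast_neg, Int.cast_one, mul_neg, mul_one] at hdt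
    linarith [hc0.1, hc0.2, hcN.1, hcN.2]
  · simp

end Summit.CriticalPhenomena.CardyFormulaZ2.Cruxes.RectilinearCardy.ExcursionKernelCovariance

end
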